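import Mathlib
import HarnessLib
import Summits.ValiantsHypothesis.ValiantsHypothesis.Theorems.LacunarySymmetroidMatrixDescartesProductPlusOneMixedSector
import Summits.ValiantsHypothesis.ValiantsHypothesis.Theorems.LacunarySymmetroidMatrixDescartesProductPlusOneTameReverse

/-!
# ValiantsHypothesis / LacunarySymmetroid — crux `MatrixDescartes` (stmt-ValiantsHypothesis-18050, V1),
# LINE (A) «product_plus_one», `stub_classRowK3`: the MIXED sector with TOP coupling (mirror of `…ProductPlusOneMixedSector`)

`mixed_sector_class_top`: supports `d 0 < d 1 < d 2` with `2(d 2 − d 1) ≤ d 2 − d 0 ≤ 4(d 2 − d 1)` (ratio measured from the top), every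
factor no-dip (`a j 0 · a j 2 < 0`) or sharp dip (`a j 0, a j 2 > 0`, negative somewhere), coupling on the TOP exponent `m·d 2` ⇒
`Z₊ ≤ 4m + 2`; by the `x ↦ 1/x` closure `card_pos_roots_class_reverse` (✓ `…TameReverse`) applied to `mixed_sector_class`, the witness
being carried to `1/x₀` (`dip_witness_reverse`).

HONEST FRAMING: bookkeeping; NOT `stub_classRowK3`, not `stub_polyLaw`, not `ProductPlusOneMDR`, not `MatrixDescartes`, not
Conjecture B; `VP ≠ VNP` is NOT proved.  No definitions, no named facts.
-/

-- `Summit.ValiantsHypothesis.ValiantsHypothesis.…` is the tree's mandated single-conjunct layout (Sub = Summit).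
set_option linter.dupNamespace false

namespace Summit.ValiantsHypothesis.ValiantsHypothesis.Theorems.LacunarySymmetroidMatrixDescartes

namespace ProductPlusOne

open Polynomial Finset
open scoped BigOperators

/-- A dip witness survives `x ↦ 1/x`: if `Σ_l a_l x₀^{d_l} < 0` at `x₀ > 0` then `Σ_l a_l (x₀⁻¹)^{D − d_l} < 0` for `D` dominating `d`.
[folklore] -/
theorem dip_witness_reverse (d : Fin 3 → ℕ) (D : ℕ) (hD : ∀ l, d l ≤ D) (a₀ a₁ a₂ x₀ : ℝ) (hx₀ : 0 < x₀)
    (h : a₀ * x₀ ^ (d 0) + a₁ * x₀ ^ (d 1) + a₂ * x₀ ^ (d 2) < 0) :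
    a₀ * x₀⁻¹ ^ (D - d 0) + a₁ * x₀⁻¹ ^ (D - d 1) + a₂ * x₀⁻¹ ^ (D - d 2) < 0 := by
  have hpow : ∀ n : ℕ, n ≤ D → x₀⁻¹ ^ (D - n) = x₀⁻¹ ^ D * x₀ ^ n := by
    intro n hn
    have hsplit : x₀ ^ D = x₀ ^ (D - n) * x₀ ^ n := by rw [← pow_add, Nat.sub_add_cancel hn]
    rw [inv_pow, inv_pow, hsplit, mul_inv, mul_assoc, inv_mul_cancel₀ (pow_ne_zero _ hx₀.ne'), mul_one]
  rw [hpow _ (hD 0), hpow _ (hD 1), hpow _ (hD 2)]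
  have hxD : 0 < x₀⁻¹ ^ D := pow_pos (inv_pos.mpr hx₀) D
  have : a₀ * (x₀⁻¹ ^ D * x₀ ^ d 0) + a₁ * (x₀⁻¹ ^ D * x₀ ^ d 1) + a₂ * (x₀⁻¹ ^ D * x₀ ^ d 2)
      = x₀⁻¹ ^ D * (a₀ * x₀ ^ (d 0) + a₁ * x₀ ^ (d 1) + a₂ * x₀ ^ (d 2)) := by ring
  rw [this]
  exact mul_neg_of_pos_of_neg hxD h

/-- **THE MIXED SECTOR WITH TOP COUPLING**: `d 0 < d 1 < d 2`, `2(d 2 − d 1) ≤ d 2 − d 0 ≤ 4(d 2 − d 1)`, every factor no-dip or sharp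
dip ⇒ the member coupled at the top exponent `m·d 2` has at most `4m + 2` positive zeros. [this file's theorem] -/
theorem mixed_sector_class_top {m : ℕ} (d : Fin 3 → ℕ) (h01 : d 0 < d 1) (h12 : d 1 < d 2)
    (h2 : 2 * (d 2 - d 1) ≤ d 2 - d 0) (h4 : d 2 - d 0 ≤ 4 * (d 2 - d 1)) (a : Fin m → Fin 3 → ℝ)
    (hfac : ∀ j, a j 0 * a j 2 < 0 ∨
      (0 < a j 0 ∧ 0 < a j 2 ∧ ∃ x₀ : ℝ, 0 < x₀ ∧ a j 0 * x₀ ^ (d 0) + a j 1 * x₀ ^ (d 1) + a j 2 * x₀ ^ (d 2) < 0)) (c : ℝ) :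
    ((C c * X ^ (m * d 2) + ∏ j, ∑ l, C (a j l) * X ^ (d l) : ℝ[X]).roots.toFinset.filter (fun t => 0 < t)).card
      ≤ 4 * m + 2 := by
  have hD : ∀ l : Fin 3, d l ≤ d 2 := by
    intro l
    fin_cases l <;> simp <;> omega
  have hrev := card_pos_roots_class_reverse d (d 2) hD a 2 c
  rw [← hrev, Nat.sub_self, mul_zero]
  have hre : (C c * X ^ 0 + ∏ j, ∑ l, C (a j l) * X ^ (d 2 - d l) : ℝ[X])
      = C c * X ^ (m * (![0, d 2 - d 1, d 2 - d 0] : Fin 3 → ℕ) 0)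
        + ∏ j, ∑ l, C ((fun j l => a j (2 - l)) j l) * X ^ ((![0, d 2 - d 1, d 2 - d 0] : Fin 3 → ℕ) l) := by
    simp only [Matrix.cons_val_zero, mul_zero]
    congr 1
    refine Finset.prod_congr rfl (fun j _ => ?_)
    simp only [Fin.sum_univ_three, Matrix.cons_val_zero, Matrix.cons_val_one, Matrix.head_cons, Matrix.cons_val_two,
      Matrix.tail_cons, Nat.sub_self]
    have e1 : (2 : Fin 3) - 0 = 2 := rfl
    have e2 : (2 : Fin 3) - 1 = 1 := rfl
    have e3 : (2 : Fin 3) - 2 = 0 := rfl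
    rw [e1, e2, e3]
    ring
  rw [hre]
  refine mixed_sector_class (![0, d 2 - d 1, d 2 - d 0]) ?_ ?_ ?_ ?_ (fun j l => a j (2 - l)) ?_ c
  · simp; omega
  · simp; omega
  · simp; omega
  · simp; omega
  · intro j
    have e1 : (2 : Fin 3) - 0 = 2 := rfl
    have e3 : (2 : Fin 3) - 2 = 0 := rfl
    have e2 : (2 : Fin 3) - 1 = 1 := rfl
    simp only [e1, e2, e3]
    rcases hfac j with hac | ⟨ha, hc, x₀, hx₀, hneg⟩
    · left
      rw [mul_comm]
      exact hac
    · right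
      refine ⟨hc, ha, x₀⁻¹, inv_pos.mpr hx₀, ?_⟩
      have hw := dip_witness_reverse d (d 2) hD (a j 0) (a j 1) (a j 2) x₀ hx₀ hneg
      simp only [Matrix.cons_val_zero, Matrix.cons_val_one, Matrix.head_cons, Matrix.cons_val_two, Matrix.tail_cons,
        Nat.sub_self, pow_zero, mul_one] at hw ⊢
      linarith

end ProductPlusOne

end Summit.ValiantsHypothesis.ValiantsHypothesis.Theorems.LacunarySymmetroidMatrixDescartes
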